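import Literature.Analysis.FluidPDE.TypeIAncientMildClassical
import Literature.Analysis.FluidPDE.AncientSimilarityVariables
import HarnessLib

/-!
# Crux `NoTypeIBlowup` (stmt-NavierStokesRegularity-1217), line `head-flux-channel`:
  STUB S1b, a global classical pressure for the rate class (`stub_ancientPressure`)

-- adapted from Cruxes/Target/S1bProof.lean (refuter-drefute-stmt-NavierStokesRegularity-1217-0,
-- 2026-08-16; same content as Cruxes/Target/HeadFluxChannelAll.lean §S1b), copied, not imported.

`stub_ancientPressure`: every Type-I ancient mild field `u` (`IsTypeIAncientMild C u`: jointly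
smooth on `t < 0`, divergence free, KNSS-mild between all pairs of negative times,
`‖u‖ ≤ C/√(−t)`) admits ONE classical pressure `q` on the whole past `(-∞, 0)`:
`IsClassicalNSSolutionOn (Iio 0) 1 0 u q`.

Proof. The tree's `IsTypeIAncientMild.exists_isClassicalNSSolutionOn_Ioo` gives a classical
pressure `pₙ` on each window `(-(n+1), 0)`. Two classical pressures of the same velocity on a
common open time set have equal gradients (momentum equation), hence agree after the
normalisation `p(t, 0) = 0` (`pressure_normalised_eq`). So
`q(t, x) := p_{⌊-t⌋₊}(t, x) - p_{⌊-t⌋₊}(t, 0)` equals `pₘ(t, x) - pₘ(t, 0)` on every window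
`(-(m+1), 0) ∋ t`; it is therefore locally (hence globally) jointly smooth on `(-∞, 0) × ℝ³`
(`contDiffOn_of_locally_contDiffOn`), and it satisfies the momentum equation with the time
derivative within `Iio 0` (which agrees with the window derivative,
`IsSmoothSpaceTimeOn.timeDerivWithin_eq_of_subset`), its gradient being that of `p_{⌊-t⌋₊}(t, ·)`.
Lands `--supports stmt-NavierStokesRegularity-1217`.
-/

noncomputable section

namespace Summit.NavierStokesRegularity.NavierStokesRegularity.Theorems.HeadFluxChannelS1b

open MeasureTheory Set Filter Topology Function
open scoped RealInnerProductSpace ContDiff Laplacian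
open Literature.Analysis.FluidPDE

/-- **Two classical pressures of one velocity on a common time set agree after normalisation at
the origin**: the momentum equation determines `∇p(t, ·)`, so `p(t, ·) - p'(t, ·)` has zero
derivative and is constant. [folklore] -/
theorem pressure_normalised_eq {S : Set ℝ} {ν : ℝ}
    {u : ℝ → EuclideanSpace ℝ (Fin 3) → EuclideanSpace ℝ (Fin 3)}
    {p p' : ℝ → EuclideanSpace ℝ (Fin 3) → ℝ}
    (h : IsClassicalNSSolutionOn S ν 0 u p) (h' : IsClassicalNSSolutionOn S ν 0 u p') {t : ℝ}
    (ht : t ∈ S) (x : EuclideanSpace ℝ (Fin 3)) :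
    p t x - p t 0 = p' t x - p' t 0 := by
  have hg : ∀ y, gradient (p t) y = gradient (p' t) y := by
    intro y
    have key := (h.momentum t ht y).symm.trans (h'.momentum t ht y)
    simpa using key
  have hd1 : Differentiable ℝ (p t) := (h.contDiff_pressure ht).differentiable (by simp)
  have hd2 : Differentiable ℝ (p' t) := (h'.contDiff_pressure ht).differentiable (by simp)
  have hf : ∀ y, fderiv ℝ (fun z => p t z - p' t z) y = 0 := by
    intro y
    rw [fderiv_fun_sub (hd1 y) (hd2 y)]
    have hy := hg y
    unfold gradient at hy
    rw [(InnerProductSpace.toDual ℝ (EuclideanSpace ℝ (Fin 3))).symm.injective hy, sub_self]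
  have hc : p t x - p' t x = p t 0 - p' t 0 :=
    is_const_of_fderiv_eq_zero (f := fun z => p t z - p' t z) (hd1.sub hd2) hf x 0
  linarith

/-- Every negative time `t` lies in the window `(-(⌊-t⌋₊ + 1), 0)`. [folklore] -/
theorem mem_window {t : ℝ} (ht : t < 0) : t ∈ Ioo (-((⌊-t⌋₊ : ℕ) + 1 : ℝ)) 0 := by
  refine ⟨?_, ht⟩
  have := Nat.lt_floor_add_one (-t)
  linarith

end Summit.NavierStokesRegularity.NavierStokesRegularity.Theorems.HeadFluxChannelS1b

namespace Summit.NavierStokesRegularity.NavierStokesRegularity.Theorems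

open MeasureTheory Set Filter Topology
open scoped RealInnerProductSpace
open Literature.Analysis.FluidPDE

open Function HeadFluxChannelS1b in
open scoped ContDiff in
/-- **S1b — a global classical pressure for the Type-I ancient mild rate class.** Every field `u`
with `IsTypeIAncientMild C u` is, for some pressure `q`, a classical solution of the unforced
Navier–Stokes system (`ν = 1`) on the whole past `(-∞, 0)`: patch the normalised window
pressures of `IsTypeIAncientMild.exists_isClassicalNSSolutionOn_Ioo` on `(-(n+1), 0)`, which agree
on overlaps by `pressure_normalised_eq`. -/
theorem stub_ancientPressure :
    ∀ (C : ℝ) (u : ℝ → EuclideanSpace ℝ (Fin 3) → EuclideanSpace ℝ (Fin 3)),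
      IsTypeIAncientMild C u →
      ∃ q : ℝ → EuclideanSpace ℝ (Fin 3) → ℝ, IsClassicalNSSolutionOn (Set.Iio 0) 1 0 u q := by
  intro C u hA
  have hwin : ∀ n : ℕ, ∃ p : ℝ → EuclideanSpace ℝ (Fin 3) → ℝ,
      IsClassicalNSSolutionOn (Ioo (-((n : ℝ) + 1)) 0) 1 0 u p := fun n =>
    hA.exists_isClassicalNSSolutionOn_Ioo (by have : (0 : ℝ) ≤ n := n.cast_nonneg; linarith)
  choose p hp using hwin
  have hsmI : IsSmoothSpaceTimeOn (Iio 0) u := hA.contDiffOn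
  -- agreement of the normalised window pressures
  have hagree : ∀ m : ℕ, ∀ t ∈ Ioo (-((m : ℝ) + 1)) 0, ∀ x : EuclideanSpace ℝ (Fin 3),
      p ⌊-t⌋₊ t x - p ⌊-t⌋₊ t 0 = p m t x - p m t 0 := by
    intro m t ht x
    set k : ℕ := min ⌊-t⌋₊ m with hk
    have hk1 : (k : ℝ) ≤ ⌊-t⌋₊ := by exact_mod_cast min_le_left _ _
    have hk2 : (k : ℝ) ≤ m := by exact_mod_cast min_le_right _ _
    have hsub1 : Ioo (-((k : ℝ) + 1)) 0 ⊆ Ioo (-((⌊-t⌋₊ : ℕ) + 1 : ℝ)) 0 :=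
      Ioo_subset_Ioo (by linarith) le_rfl
    have hsub2 : Ioo (-((k : ℝ) + 1)) 0 ⊆ Ioo (-((m : ℝ) + 1)) 0 :=
      Ioo_subset_Ioo (by linarith) le_rfl
    have htk : t ∈ Ioo (-((k : ℝ) + 1)) 0 := by
      rcases min_choice ⌊-t⌋₊ m with hmin | hmin
      · rw [hk, hmin]; exact mem_window ht.2
      · rw [hk, hmin]; exact ht
    exact pressure_normalised_eq ((hp ⌊-t⌋₊).mono hsub1 (uniqueDiffOn_Ioo _ _))
      ((hp m).mono hsub2 (uniqueDiffOn_Ioo _ _)) htk x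
  refine ⟨fun t x => p ⌊-t⌋₊ t x - p ⌊-t⌋₊ t 0, hsmI, ?_, ?_, fun t ht => hA.isDivFree ht⟩
  · -- joint smoothness of the patched pressure: it is locally one of the window pressures
    refine contDiffOn_of_locally_contDiffOn fun z hz => ?_
    have ht : z.1 < 0 := (mem_prod.1 hz).1
    set m : ℕ := ⌊-z.1⌋₊ with hm
    refine ⟨Ioo (-((m : ℝ) + 1)) 0 ×ˢ univ, isOpen_Ioo.prod isOpen_univ,
      ⟨by rw [hm]; exact mem_window ht, mem_univ _⟩, ?_⟩
    have hP : ContDiffOn ℝ ∞ (uncurry (p m)) (Ioo (-((m : ℝ) + 1)) 0 ×ˢ univ) :=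
      (hp m).smooth_pressure
    have hP0 : ContDiffOn ℝ ∞ (fun w : ℝ × EuclideanSpace ℝ (Fin 3) => uncurry (p m) (w.1, 0))
        (Ioo (-((m : ℝ) + 1)) 0 ×ˢ univ) :=
      hP.comp (contDiffOn_fst.prodMk contDiffOn_const)
        (fun w hw => ⟨(mem_prod.1 hw).1, mem_univ _⟩)
    refine ((hP.sub hP0).mono fun w hw => hw.2).congr fun w hw => ?_
    exact hagree m w.1 (mem_prod.1 hw.2).1 w.2
  · -- momentum with the time derivative within `Iio 0`
    intro t ht x
    have htN := mem_window ht
    have hmom := (hp ⌊-t⌋₊).momentum t htN x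
    have htd : timeDerivWithin (Ioo (-((⌊-t⌋₊ : ℕ) + 1 : ℝ)) 0) u t x =
        timeDerivWithin (Iio 0) u t x :=
      hsmI.timeDerivWithin_eq_of_subset (fun s hs => hs.2) (uniqueDiffOn_Ioo _ _) htN x
    have hgrad : gradient (fun y => p ⌊-t⌋₊ t y - p ⌊-t⌋₊ t 0) x = gradient (p ⌊-t⌋₊ t) x := by
      simp only [gradient, fderiv_sub_const]
    rw [← htd, hgrad]
    exact hmom

end Summit.NavierStokesRegularity.NavierStokesRegularity.Theorems

end
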